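import Summits.ValiantsHypothesis.ValiantsHypothesis.Theorems.KPlusLogSqLawTropicalBMatchingInterlacing

/-!
# Route «KPlusLogSqLaw», crux `TropicalB` (stmt-ValiantsHypothesis-19771) — BASIS EXCHANGE FOR PERFECT MATCHINGS OF ONE COLUMN SET
# (the valuated-matroid exchange axiom of the assignment valuation, witness form)

HONEST FRAMING.  Helper toward the registered stubs `stub_tropThin` / `stub_tropFat` of `Cruxes/TropicalB/Lines/birth.lean` (crux
`Summit.ValiantsHypothesis.ValiantsHypothesis.Theses.KPlusLogSqLaw.TropicalB`, item stmt-ValiantsHypothesis-19771, route KPlusLogSqLaw;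
cell `pub-symmetroid`, seat val-sym-trop-p4 g11, 2026-08-27; `--supports … --as helper`).  A COMBINATORIAL ENGINE about matchings of an
arbitrary bipartite graph, consumed by the REGISTER-PAIR LAW (…TropicalBRegisterPair); nothing here bounds `TropicalB`, and nothing bears
on `WeakLifting`, DoorA26 / DoorA34, `MatrixDescartes` (stmt-ValiantsHypothesis-18050) or VP ≠ VNP.

THE STATEMENT (`basis_exchange`).  Let `M`, `M'` be matchings (`IsPMatching`, the tree's `Literature.…PBij` vocabulary on `Finset (α × β)`)
with the same number of edges and the same column set `rng M = rng M'`, and let `x` be a row of `M` that is not a row of `M'`.  Then there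
is a row `z` of `M'` that is not a row of `M`, and matchings `X`, `Y` with the SAME multiset of edges as `M`, `M'`
(`X ∪ Y = M ∪ M'`, `X ∩ Y = M ∩ M'` — so weights add up for every weight, `MatchingExchange.wt_add_eq`), the same column set, and row sets
`dom X = dom M − x + z`, `dom Y = dom M' − z + x`.  This is the exchange axiom of the valuated matroid induced by a weighted bipartite graph
on its row side (Murota's network induction; Dress–Wenzel), in the witness form the cell's files consume.  Proof: delete the edge of `x`
from `M` and apply the tree's AUGMENTING-PATH EXCHANGE `MatchingExchange.exchange` (…TropicalBMatchingExchange) to the deficient matching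
and `M'`; the bookkeeping (`row_exclusive`, `col_exclusive'`, …TropicalBMatchingInterlacing) identifies the row and column sets of the two
new matchings, and the deleted edge is put back on the deficient side.

[folklore: Berge 1957 (alternating paths); Murota, Discrete Convex Analysis (2003) §9 (valuated matroids from bipartite graphs);
Dress–Wenzel 1992]
-/

set_option linter.dupNamespace false
set_option autoImplicit false

namespace Summit.ValiantsHypothesis.ValiantsHypothesis.Theorems.KPlusLogSqLaw

namespace MatchingExchange

open Finset
open scoped BigOperators
open Literature.Computability.MetaComplexity.PBij

variable {α β : Type*} [DecidableEq α] [DecidableEq β]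

/-! ### Small facts: erasing and inserting one edge -/

/-- Erasing an edge of a matching erases its row from the domain. [folklore] -/
theorem dom_erase_eq {M : Finset (α × β)} (hM : IsPMatching M) {x : α} {g : β} (he : (x, g) ∈ M) :
    dom (M.erase (x, g)) = (dom M).erase x := by
  ext a
  simp only [mem_dom, Finset.mem_erase]
  constructor
  · rintro ⟨b, hne, hb⟩
    refine ⟨?_, b, hb⟩
    rintro rfl
    exact hne (hM _ hb _ he (Or.inl rfl))
  · rintro ⟨hne, b, hb⟩
    exact ⟨b, fun h => hne (Prod.mk.inj h).1, hb⟩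

/-- Erasing an edge of a matching erases its column from the range. [folklore] -/
theorem rng_erase_eq {M : Finset (α × β)} (hM : IsPMatching M) {x : α} {g : β} (he : (x, g) ∈ M) :
    rng (M.erase (x, g)) = (rng M).erase g := by
  ext b
  simp only [mem_rng, Finset.mem_erase]
  constructor
  · rintro ⟨a, hne, ha⟩
    refine ⟨?_, a, ha⟩
    rintro rfl
    exact hne (hM _ ha _ he (Or.inr rfl))
  · rintro ⟨hne, a, ha⟩
    exact ⟨a, fun h => hne (Prod.mk.inj h).2, ha⟩

/-- Inserting an edge whose row and column are both free keeps a matching a matching. [folklore] -/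
theorem isPMatching_insert {N : Finset (α × β)} (hN : IsPMatching N) {x : α} {g : β} (hx : x ∉ dom N)
    (hg : g ∉ rng N) : IsPMatching (insert (x, g) N) := by
  intro p hp q hq hpq
  rcases Finset.mem_insert.1 hp with rfl | hp' <;> rcases Finset.mem_insert.1 hq with rfl | hq'
  · rfl
  · rcases hpq with h | h
    · exact absurd (mem_dom.2 ⟨q.2, by rw [show (x, q.2) = q from Prod.ext h rfl]; exact hq'⟩) hx
    · exact absurd (mem_rng.2 ⟨q.1, by rw [show (q.1, g) = q from Prod.ext rfl h]; exact hq'⟩) hg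
  · rcases hpq with h | h
    · exact absurd (mem_dom.2 ⟨p.2, by rw [show (x, p.2) = p from Prod.ext h.symm rfl]; exact hp'⟩) hx
    · exact absurd (mem_rng.2 ⟨p.1, by rw [show (p.1, g) = p from Prod.ext rfl h.symm]; exact hp'⟩) hg
  · exact hN p hp' q hq' hpq

/-- Domain of a matching with one more edge. [folklore] -/
theorem dom_insert_eq (N : Finset (α × β)) (x : α) (g : β) : dom (insert (x, g) N) = insert x (dom N) := by
  simp [dom, Finset.image_insert]

/-- Range of a matching with one more edge. [folklore] -/
theorem rng_insert_eq (N : Finset (α × β)) (x : α) (g : β) : rng (insert (x, g) N) = insert g (rng N) := by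
  simp [rng, Finset.image_insert]

/-! ### The basis exchange -/

/-- **BASIS EXCHANGE (valuated-matroid exchange axiom for the rows of equinumerous matchings with a common column set).**
If `M`, `M'` are matchings with `|M| = |M'|`, `rng M = rng M'`, and `x ∈ dom M ∖ dom M'`, then for some `z ∈ dom M' ∖ dom M` there are
matchings `X`, `Y` with `X ∪ Y = M ∪ M'`, `X ∩ Y = M ∩ M'` (same edge multiset), `rng X = rng Y = rng M`,
`dom X = (dom M − x) + z` and `dom Y = (dom M' − z) + x`.
[folklore: Murota, Discrete Convex Analysis (2003) §9; from the tree's `MatchingExchange.exchange`] -/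
theorem basis_exchange {M M' : Finset (α × β)} (hM : IsPMatching M) (hM' : IsPMatching M')
    (hcard : M.card = M'.card) (hrng : rng M = rng M') {x : α} (hx : x ∈ dom M) (hx' : x ∉ dom M') :
    ∃ z, z ∈ dom M' ∧ z ∉ dom M ∧ ∃ X Y : Finset (α × β), IsPMatching X ∧ IsPMatching Y ∧
      X ∪ Y = M ∪ M' ∧ X ∩ Y = M ∩ M' ∧ rng X = rng M ∧ rng Y = rng M ∧
      dom X = insert z ((dom M).erase x) ∧ dom Y = insert x ((dom M').erase z) := by
  classical
  obtain ⟨g, hxg⟩ := mem_dom.1 hx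
  set M₀ := M.erase (x, g) with hM₀def
  have hM₀ : IsPMatching M₀ := hM.subset (Finset.erase_subset _ _)
  have hcard₀ : M₀.card + 1 = M.card := Finset.card_erase_add_one hxg
  have hlt : M₀.card < M'.card := by omega
  obtain ⟨N₁, N₂, hN₁, hN₂, hU, hI, hc₁, hdom₁, hrng₁⟩ := exchange hM₀ hM' hlt
  have hdomM₀ : dom M₀ = (dom M).erase x := dom_erase_eq hM hxg
  have hrngM₀ : rng M₀ = (rng M).erase g := rng_erase_eq hM hxg
  have hxM₀ : x ∉ dom M₀ := by rw [hdomM₀]; exact Finset.notMem_erase _ _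
  have hgM₀ : g ∉ rng M₀ := by rw [hrngM₀]; exact Finset.notMem_erase _ _
  have hgM : g ∈ rng M := mem_rng.2 ⟨x, hxg⟩
  have heM' : (x, g) ∉ M' := fun h => hx' (mem_dom.2 ⟨g, h⟩)
  have hc₂ : N₂.card + 1 = M'.card := card_add_eq hU hI hc₁
  -- `rng N₁ = rng M`
  have hrngN₁ : rng N₁ = rng M := by
    apply Finset.eq_of_subset_of_card_le
    · intro b hb
      have h := rng_mono (subset_union_left hU) hb
      rw [rng_union, hrngM₀, ← hrng] at h
      rcases Finset.mem_union.1 h with h | h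
      · exact Finset.mem_of_mem_erase h
      · exact h
    · rw [hN₁.card_rng, hc₁, hcard₀, hM.card_rng]
  -- `x ∉ dom N₁`
  have hxN₁ : x ∉ dom N₁ := by
    intro h
    have h' := dom_mono (subset_union_left hU) h
    rw [dom_union] at h'
    rcases Finset.mem_union.1 h' with h' | h'
    · exact hxM₀ h'
    · exact hx' h'
  -- the new row `z`
  have hsub : (dom M).erase x ⊆ dom N₁ := hdomM₀ ▸ hdom₁
  have hcardN₁ : (dom N₁).card = ((dom M).erase x).card + 1 := by
    rw [hN₁.card_dom, hc₁, Finset.card_erase_of_mem hx, hM.card_dom]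
    have : 0 < M.card := Finset.card_pos.2 ⟨_, hxg⟩
    omega
  have hne : (dom N₁ \ (dom M).erase x).Nonempty := by
    rw [← Finset.card_pos, Finset.card_sdiff_of_subset hsub]; omega
  obtain ⟨z, hz⟩ := hne
  rw [Finset.mem_sdiff] at hz
  have hzN₁ : z ∈ dom N₁ := hz.1
  have hzx : z ≠ x := by rintro rfl; exact hxN₁ hzN₁
  have hzM : z ∉ dom M := fun h => hz.2 (Finset.mem_erase.2 ⟨hzx, h⟩)
  have hzM₀ : z ∉ dom M₀ := by rw [hdomM₀]; exact hz.2
  have hzM' : z ∈ dom M' := by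
    have h' := dom_mono (subset_union_left hU) hzN₁
    rw [dom_union] at h'
    rcases Finset.mem_union.1 h' with h' | h'
    · exact absurd h' hzM₀
    · exact h'
  have hdomN₁ : dom N₁ = insert z ((dom M).erase x) := by
    symm
    apply Finset.eq_of_subset_of_card_le
    · exact Finset.insert_subset hzN₁ hsub
    · rw [Finset.card_insert_of_notMem hz.2, hcardN₁]
  -- `rng N₂ = rng M − g`
  have hgN₁ : g ∈ rng N₁ := hrngN₁ ▸ hgM
  have hgN₂ : g ∉ rng N₂ := col_exclusive' hU hI hM' hgM₀ hgN₁
  have hrngN₂ : rng N₂ = (rng M).erase g := by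
    apply Finset.eq_of_subset_of_card_le
    · intro b hb
      have h := rng_mono (subset_union_right hU) hb
      rw [rng_union, hrngM₀, ← hrng] at h
      refine Finset.mem_erase.2 ⟨?_, ?_⟩
      · rintro rfl; exact hgN₂ hb
      · rcases Finset.mem_union.1 h with h | h
        · exact Finset.mem_of_mem_erase h
        · exact h
    · rw [hN₂.card_rng, Finset.card_erase_of_mem hgM, hM.card_rng]; omega
  -- `dom N₂ = dom M' − z`
  have hzN₂ : z ∉ dom N₂ := row_exclusive' hU hI hM' hzM₀ hzN₁
  have hdomN₂ : dom N₂ = (dom M').erase z := by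
    apply Finset.eq_of_subset_of_card_le
    · intro a ha
      refine Finset.mem_erase.2 ⟨?_, ?_⟩
      · rintro rfl; exact hzN₂ ha
      · by_contra haM'
        have h := dom_mono (subset_union_right hU) ha
        rw [dom_union] at h
        rcases Finset.mem_union.1 h with h | h
        · exact row_exclusive hU hI hM₀ haM' (hdom₁ h) ha
        · exact haM' h
    · rw [hN₂.card_dom, Finset.card_erase_of_mem hzM', hM'.card_dom]; omega
  -- put the edge `(x, g)` back on the deficient side
  have hxN₂ : x ∉ dom N₂ := by rw [hdomN₂]; exact fun h => hx' (Finset.mem_of_mem_erase h)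
  have heN₁ : (x, g) ∉ N₁ := fun h => hxN₁ (mem_dom.2 ⟨g, h⟩)
  refine ⟨z, hzM', hzM, N₁, insert (x, g) N₂, hN₁, isPMatching_insert hN₂ hxN₂ hgN₂, ?_, ?_, hrngN₁, ?_, hdomN₁, ?_⟩
  · rw [Finset.union_insert, hU, hM₀def, ← Finset.insert_union, Finset.insert_erase hxg]
  · rw [Finset.inter_insert_of_notMem heN₁, hI, hM₀def, Finset.erase_inter, Finset.erase_eq_of_notMem]
    exact fun h => heM' (Finset.mem_inter.1 h).2
  · rw [rng_insert_eq, hrngN₂, Finset.insert_erase hgM]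
  · rw [dom_insert_eq, hdomN₂]

end MatchingExchange

end Summit.ValiantsHypothesis.ValiantsHypothesis.Theorems.KPlusLogSqLaw
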